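import Summits.Ventures.YMGap.RobustBall.ThermodynamicVariance
import Summits.Ventures.YMGap.RobustBall.ErgodicAverages
import Summits.Ventures.YMGap.Thresholds.PressureSecondDerivative
import HarnessLib

/-!
# Venture YMGap, track ROBUST-BALL — SPECIFIC HEAT = ENERGY FLUCTUATION DENSITY: for `SU(2)` lattice Yang–Mills on `ℤ⁴` in the
# vertex-star window, the variance per site of the plaquette energy of a cube converges to `¼ f''(β)`

HONEST FRAMING. WHAT THIS IS: a venture file (cell `pub-ymgap`, track Y2 ROBUST-BALL, seat ds-3, theorems only) joining two tree
theorems: ds-1's C-DIFF identity `f''(β) = Σ_{i<j} 4 Σ_q Cov_ν(W_{p_ij}, W_q)` (`PressureRegularity.su2_deriv_deriv_freeEnergyDensity_eq`,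
`0 < β < 9/50` tree coupling, `β_W = 2β`) and this seat's thermodynamic variance theorem (`ThermodynamicVariance.tendsto_variance_boxSum_div`).
Result (`su2_tendsto_variance_energy_boxSum_div`): for the unique DLR state `ν` of `SU(2)` on `ℤ⁴` at tree coupling `0 < β < 9/50` and
the plaquette energy density at the origin `e(U) = Σ_{i<j} W_{(0;i,j)}(U)`, `W_p = ½ Re tr U_p`:

  `Var_ν(Σ_{x∈B_n} e∘θ_x) / #B_n  →  ¼ · f''(β)`   (`B_n = siteBox 4 n`, `#B_n = (2n+1)⁴`),

i.e. the thermodynamic fluctuation density of the energy IS the second derivative of the free energy density (the lattice «specific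
heat», up to the fixed normalisation `¼` of the tree's coupling convention) — the fluctuation–dissipation theorem in infinite volume as a
kernel statement. Tools: `zdPlaquetteObs_configShift` (`W_{(x;i,j)}∘θ_v = W_{(x−v;i,j)}`), `tsum_covariance_energy_shift_eq` (the
autocovariance series of `e` rearranged into ds-1's plaquette susceptibility, absolutely convergent by `PlaquetteSusceptibility`).
WHAT THIS IS NOT: no claim outside `0 < β_W < 9/25`, no statement about the sign or size of `f''` beyond ds-1's, not a CLT; lattice;
nothing about the continuum limit or the Clay problem.

References: B. Simon, *The Statistical Mechanics of Lattice Gases* I (1993), §II.12 (fluctuations and the second derivative of the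
pressure); the tree's `PressureSecondDerivative.lean` (ds-1), `ThermodynamicVariance.lean` (ds-3).
-/

noncomputable section

open MeasureTheory Filter Function ProbabilityTheory Real Topology Set
open scoped NNReal
open Literature.Probability.LatticeModels hiding configShift configShift_apply
open Literature.MathematicalPhysics.QuantumLattice
open Literature.MathematicalPhysics.QuantumFieldTheory hiding ZdEdge Site IsLocalObservable
open Summit.Ventures.YMGap.RobustBall.ThermodynamicVariance
open Literature.Probability.LatticeModels.DobrushinMetric (integrable_of_abs_le')

namespace Summit.Ventures.YMGap.RobustBall

namespace SpecificHeat

variable {d N : ℕ} {G : Type*} [Group G] [MeasurableSpace G] {ρ : G →* Matrix (Fin N) (Fin N) ℂ}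

/-! ### Plaquette observables under lattice translations -/

/-- `W_{(x;i,j)}(θ_v U) = W_{(x−v;i,j)}(U)`: a translated configuration read on the plaquette at `x` is the configuration read on
the plaquette at `x − v`. [folklore] -/
theorem zdPlaquetteObs_configShift (x v : Site d) (i j : Fin d) (U : LGConfig d G) :
    zdPlaquetteObs ρ x i j (configShift v U) = zdPlaquetteObs ρ (x - v) i j U := by
  simp only [zdPlaquetteObs, ZdGaugeConfig.plaquette, configShift_apply, add_sub_right_comm]

/-! ### The autocovariance series of the energy density is ds-1's plaquette susceptibility -/

/-- **Rearrangement**: for a probability measure `ν` on the `SU(N)` link configurations of `ℤ^d` under which every plaquette has an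
absolutely summable covariance row (`Σ_r |cov_ν(W_{(0;q)}, W_r)| < ∞` for each orientation `q`), the autocovariance series of the
energy density `e = Σ_q W_{(0;q)}` is absolutely summable and equals `Σ_q Σ_r cov_ν(W_{(0;q)}, W_r)`. [folklore] -/
theorem tsum_covariance_energy_shift_eq {ν : Measure (LGConfig d (Matrix.specialUnitaryGroup (Fin N) ℂ))}
    [IsProbabilityMeasure ν]
    (hsum : ∀ q : {q : Fin d × Fin d // q.1 < q.2}, Summable fun r : ZdPlaquette d =>
      |cov[zdPlaquetteObs (fundamentalRep (Fin N)) 0 q.1.1 q.1.2,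
        zdPlaquetteObs (fundamentalRep (Fin N)) r.1 r.2.1.1 r.2.1.2; ν]|) :
    (Summable fun v : Site d => |cov[fun U => ∑ q : {q : Fin d × Fin d // q.1 < q.2},
        zdPlaquetteObs (fundamentalRep (Fin N)) 0 q.1.1 q.1.2 U,
      fun U => ∑ q : {q : Fin d × Fin d // q.1 < q.2},
        zdPlaquetteObs (fundamentalRep (Fin N)) 0 q.1.1 q.1.2 (configShift v U); ν]|) ∧
    ∑' v : Site d, cov[fun U => ∑ q : {q : Fin d × Fin d // q.1 < q.2}, zdPlaquetteObs (fundamentalRep (Fin N)) 0 q.1.1 q.1.2 U,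
        fun U => ∑ q : {q : Fin d × Fin d // q.1 < q.2},
          zdPlaquetteObs (fundamentalRep (Fin N)) 0 q.1.1 q.1.2 (configShift v U); ν] =
      ∑ q : {q : Fin d × Fin d // q.1 < q.2}, ∑' r : ZdPlaquette d,
        cov[zdPlaquetteObs (fundamentalRep (Fin N)) 0 q.1.1 q.1.2,
          zdPlaquetteObs (fundamentalRep (Fin N)) r.1 r.2.1.1 r.2.1.2; ν] := by
  classical
  set W : ZdPlaquette d → LGConfig d (Matrix.specialUnitaryGroup (Fin N) ℂ) → ℝ :=
    fun r => zdPlaquetteObs (fundamentalRep (Fin N)) r.1 r.2.1.1 r.2.1.2 with hW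
  set g : {q : Fin d × Fin d // q.1 < q.2} → ZdPlaquette d → ℝ := fun q r => cov[W (0, q), W r; ν] with hg
  have hmem : ∀ r : ZdPlaquette d, MemLp (W r) 2 ν := fun r =>
    memLp_of_bounded (a := -1) (b := 1)
      (ae_of_all _ fun U => by
        have h1 := abs_zdPlaquetteObs_le fundamentalRep_mem_unitaryGroup r.1 r.2.1.1 r.2.1.2 U
        simp only [Set.mem_Icc]; exact abs_le.1 h1)
      (isLipschitzCylinder_zdPlaquetteObs r.1 r.2.2).measurable.aestronglyMeasurable 2
  -- the autocovariance at `v` as a finite double sum of plaquette covariances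
  have hcov : ∀ v : Site d,
      cov[fun U => ∑ q : {q : Fin d × Fin d // q.1 < q.2}, W (0, q) U,
        fun U => ∑ q : {q : Fin d × Fin d // q.1 < q.2}, W (0, q) (configShift v U); ν] =
        ∑ q : {q : Fin d × Fin d // q.1 < q.2}, ∑ q' : {q : Fin d × Fin d // q.1 < q.2}, g q (-v, q') := by
    intro v
    have hshift : (fun U => ∑ q : {q : Fin d × Fin d // q.1 < q.2}, W (0, q) (configShift v U)) =
        ∑ q : {q : Fin d × Fin d // q.1 < q.2}, W (-v, q) := by
      funext U
      simp only [hW, Finset.sum_apply, zdPlaquetteObs_configShift, zero_sub]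
    have hleft : (fun U => ∑ q : {q : Fin d × Fin d // q.1 < q.2}, W (0, q) U) =
        ∑ q : {q : Fin d × Fin d // q.1 < q.2}, W (0, q) := by
      funext U; simp
    rw [hshift, hleft, covariance_sum_sum' (fun q _ => hmem (0, q)) (fun q' _ => hmem (-v, q'))]
  -- absolute summability
  have habs : ∀ v : Site d, |∑ q : {q : Fin d × Fin d // q.1 < q.2}, ∑ q' : {q : Fin d × Fin d // q.1 < q.2}, g q (-v, q')| ≤
      ∑ q : {q : Fin d × Fin d // q.1 < q.2}, ∑ q' : {q : Fin d × Fin d // q.1 < q.2}, |g q (-v, q')| := fun v =>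
    (Finset.abs_sum_le_sum_abs _ _).trans (Finset.sum_le_sum fun q _ => Finset.abs_sum_le_sum_abs _ _)
  -- the majorant `v ↦ Σ_q Σ_q' |g q (−v, q')|` is summable: it is a finite sum of rearranged summable rows
  have hrow : ∀ q q' : {q : Fin d × Fin d // q.1 < q.2}, Summable fun v : Site d => |g q (-v, q')| := by
    intro q q'
    have h1 : Summable fun v : Site d => |g q (v, q')| :=
      (hsum q).comp_injective (f := fun r : ZdPlaquette d => |g q r|)
        (show Function.Injective (fun v : Site d => ((v, q') : ZdPlaquette d)) from
          fun a b h => (Prod.mk.inj h).1)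
    exact (Equiv.neg (Site d)).summable_iff.2 h1
  have hmaj : Summable fun v : Site d =>
      ∑ q : {q : Fin d × Fin d // q.1 < q.2}, ∑ q' : {q : Fin d × Fin d // q.1 < q.2}, |g q (-v, q')| :=
    summable_sum fun q _ => summable_sum fun q' _ => hrow q q'
  have hS : Summable fun v : Site d => |cov[fun U => ∑ q : {q : Fin d × Fin d // q.1 < q.2}, W (0, q) U,
      fun U => ∑ q : {q : Fin d × Fin d // q.1 < q.2}, W (0, q) (configShift v U); ν]| := by
    refine Summable.of_nonneg_of_le (fun v => abs_nonneg _) (fun v => ?_) hmaj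
    rw [hcov v]; exact habs v
  refine ⟨hS, ?_⟩
  -- the rearrangement itself
  have hcol : ∀ q q' : {q : Fin d × Fin d // q.1 < q.2}, Summable fun v : Site d => g q (v, q') := fun q q' =>
    ((hsum q).of_abs).comp_injective
      (show Function.Injective (fun v : Site d => ((v, q') : ZdPlaquette d)) from fun a b h => (Prod.mk.inj h).1)
  have hneg : ∀ q q' : {q : Fin d × Fin d // q.1 < q.2}, ∑' v : Site d, g q (-v, q') = ∑' v : Site d, g q (v, q') :=
    fun q q' => (Equiv.neg (Site d)).tsum_eq (fun v => g q (v, q'))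
  have hq : ∀ q : {q : Fin d × Fin d // q.1 < q.2},
      ∑' r : ZdPlaquette d, g q r = ∑ q' : {q : Fin d × Fin d // q.1 < q.2}, ∑' v : Site d, g q (v, q') := by
    intro q
    rw [(hsum q).of_abs.tsum_prod]
    simp_rw [tsum_fintype]
    exact Summable.tsum_finsetSum fun q' _ => hcol q q'
  calc ∑' v : Site d, cov[fun U => ∑ q : {q : Fin d × Fin d // q.1 < q.2}, W (0, q) U,
          fun U => ∑ q : {q : Fin d × Fin d // q.1 < q.2}, W (0, q) (configShift v U); ν]
      = ∑' v : Site d, ∑ q : {q : Fin d × Fin d // q.1 < q.2}, ∑ q' : {q : Fin d × Fin d // q.1 < q.2}, g q (-v, q') :=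
        tsum_congr fun v => hcov v
    _ = ∑ q : {q : Fin d × Fin d // q.1 < q.2}, ∑' v : Site d, ∑ q' : {q : Fin d × Fin d // q.1 < q.2}, g q (-v, q') :=
        Summable.tsum_finsetSum fun q _ => summable_sum fun q' _ => (hrow q q').of_abs
    _ = ∑ q : {q : Fin d × Fin d // q.1 < q.2}, ∑ q' : {q : Fin d × Fin d // q.1 < q.2}, ∑' v : Site d, g q (-v, q') :=
        Finset.sum_congr rfl fun q _ => Summable.tsum_finsetSum fun q' _ => (hrow q q').of_abs
    _ = ∑ q : {q : Fin d × Fin d // q.1 < q.2}, ∑ q' : {q : Fin d × Fin d // q.1 < q.2}, ∑' v : Site d, g q (v, q') := by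
        simp_rw [hneg]
    _ = ∑ q : {q : Fin d × Fin d // q.1 < q.2}, ∑' r : ZdPlaquette d, g q r :=
        Finset.sum_congr rfl fun q _ => (hq q).symm

/-! ### The specific heat of `SU(2)` lattice Yang–Mills on `ℤ⁴` as a fluctuation density -/

/-- ★★★ **SPECIFIC HEAT = ENERGY FLUCTUATION DENSITY** (`SU(2)`, `ℤ⁴`, tree coupling `0 < β < 9/50`, i.e. `0 < β_W < 9/25`): for
the unique DLR state `ν` (translation invariant, `su2_wilson_oneState_translationInvariant`) and the plaquette energy density at the
origin `e = Σ_{i<j} W_{(0;i,j)}`, `W_p = ½ Re tr U_p`: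
`Var_ν(Σ_{x∈B_n} e∘θ_x) / #B_n → ¼ · f''(β)` — ds-1's `f'' = 4 Σ_{i<j} Σ_q Cov(W_{p_ij}, W_q)`
(`PressureRegularity.su2_deriv_deriv_freeEnergyDensity_eq`) is the thermodynamic variance density of the energy
(`ThermodynamicVariance.tendsto_variance_boxSum_div` + `tsum_covariance_energy_shift_eq` + ds-1's plaquette susceptibility). [folklore] -/
theorem su2_tendsto_variance_energy_boxSum_div {b : ℝ} (hb : b ∈ Ioo (0 : ℝ) (9 / 50)) :
    ∃ ν : Measure (LGConfig 4 (Matrix.specialUnitaryGroup (Fin 2) ℂ)),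
      ymGibbsMeasures (d := 4) (fundamentalRep (Fin 2)) b = {ν} ∧
      Tendsto (fun n : ℕ => Var[fun U => ∑ x ∈ siteBox 4 n, ∑ q : {q : Fin 4 × Fin 4 // q.1 < q.2},
          zdPlaquetteObs (fundamentalRep (Fin 2)) 0 q.1.1 q.1.2 (configShift x U); ν] / (siteBox 4 n).card) atTop
        (𝓝 ((1 / 4 : ℝ) * deriv (deriv (freeEnergyDensity 4 (fundamentalRep (Fin 2)))) b)) := by
  classical
  have hb' : |b| ≤ 9 / 50 := abs_le.2 ⟨by linarith [hb.1], hb.2.le⟩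
  obtain ⟨ν, hG, hinv⟩ := su2_wilson_oneState_translationInvariant hb'
  have hν : ν ∈ ymGibbsMeasures (d := 4) (fundamentalRep (Fin 2)) b := by rw [hG]; exact Set.mem_singleton ν
  have hνG : IsGibbsMeasure (ymSpecification (d := 4) (fundamentalRep (Fin 2)) b) ν := hν
  haveI := hνG.isProbabilityMeasure
  -- ds-1's plaquette susceptibility: every covariance row is absolutely summable
  have hb2 : |b / 2| ≤ 9 / 100 := by rw [abs_div, abs_two]; linarith
  have hν2 : ν ∈ ymGibbsMeasures (d := 4) (fundamentalRep (Fin 2)) (2 * (b / 2)) := by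
    rw [show (2 : ℝ) * (b / 2) = b by ring]; exact hν
  obtain ⟨χ, hχ⟩ := PlaquetteSusceptibility.su2_summable_abs_cov_plaquette hb2 hν2
  have hsum : ∀ q : {q : Fin 4 × Fin 4 // q.1 < q.2}, Summable fun r : ZdPlaquette 4 =>
      |cov[zdPlaquetteObs (fundamentalRep (Fin 2)) 0 q.1.1 q.1.2,
        zdPlaquetteObs (fundamentalRep (Fin 2)) r.1 r.2.1.1 r.2.1.2; ν]| := fun q => (hχ (0, q)).1
  obtain ⟨hS, hI⟩ := tsum_covariance_energy_shift_eq (d := 4) (N := 2) (ν := ν) hsum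
  -- the energy density is bounded and measurable
  set e : LGConfig 4 (Matrix.specialUnitaryGroup (Fin 2) ℂ) → ℝ :=
    fun U => ∑ q : {q : Fin 4 × Fin 4 // q.1 < q.2}, zdPlaquetteObs (fundamentalRep (Fin 2)) 0 q.1.1 q.1.2 U with he
  have hem : Measurable e :=
    Finset.measurable_sum _ fun q _ => (isLipschitzCylinder_zdPlaquetteObs (N := 2) 0 q.2).measurable
  have heb : ∀ U, |e U| ≤ (Finset.univ : Finset {q : Fin 4 × Fin 4 // q.1 < q.2}).card := fun U => by
    refine (Finset.abs_sum_le_sum_abs _ _).trans ?_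
    calc ∑ q : {q : Fin 4 × Fin 4 // q.1 < q.2}, |zdPlaquetteObs (fundamentalRep (Fin 2)) 0 q.1.1 q.1.2 U|
        ≤ ∑ _q : {q : Fin 4 × Fin 4 // q.1 < q.2}, (1 : ℝ) :=
          Finset.sum_le_sum fun q _ => abs_zdPlaquetteObs_le fundamentalRep_mem_unitaryGroup 0 q.1.1 q.1.2 U
      _ = (Finset.univ : Finset {q : Fin 4 × Fin 4 // q.1 < q.2}).card := by simp
  have hlim := tendsto_variance_boxSum_div hinv hem heb hS
  -- identify the limit with `¼ f''(b)`
  have hderiv := PressureRegularity.su2_deriv_deriv_freeEnergyDensity_eq hb hν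
  have hval : ∑' v : Site 4, cov[e, fun U => e (configShift v U); ν] =
      (1 / 4 : ℝ) * deriv (deriv (freeEnergyDensity 4 (fundamentalRep (Fin 2)))) b := by
    rw [hderiv, Finset.mul_sum]
    simp only [he]
    rw [hI]
    refine Finset.sum_congr rfl fun q _ => ?_
    ring
  refine ⟨ν, hG, ?_⟩
  rw [← hval]
  exact hlim

/-! ### The internal energy density of a typical configuration -/

/-- ★★ **THE ENERGY DENSITY OF A SINGLE INFINITE-VOLUME SAMPLE IS `6 + ½ f'(β)` ALMOST SURELY** (`SU(2)`, `ℤ⁴`, tree coupling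
`0 < β < 9/50`): for the unique DLR state `ν`, for `ν`-almost every configuration `U`, the empirical energy density over the cubes
`#B_n⁻¹ Σ_{x∈B_n} e(θ_x U)` converges to `⟨e⟩_ν = 6 + ½ f'(β)` (ds-1's first thermodynamic identity
`PressureRegularity.su2_hasDerivAt_freeEnergyDensity_of_mem`: `f'(β) = −Σ_{i<j}(2 − ⟨Re tr U_{p_ij}⟩)`, `Re tr = 2W`; this seat's
almost-sure ergodic theorem `ErgodicAverages.ae_tendsto_boxAverage` with the absolutely summable energy autocovariance). [folklore] -/
theorem su2_ae_tendsto_energy_boxAverage {b : ℝ} (hb : b ∈ Ioo (0 : ℝ) (9 / 50)) :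
    ∃ ν : Measure (LGConfig 4 (Matrix.specialUnitaryGroup (Fin 2) ℂ)),
      ymGibbsMeasures (d := 4) (fundamentalRep (Fin 2)) b = {ν} ∧
      ∀ᵐ U ∂ν, Tendsto (fun n : ℕ => (∑ x ∈ siteBox 4 n, ∑ q : {q : Fin 4 × Fin 4 // q.1 < q.2},
          zdPlaquetteObs (fundamentalRep (Fin 2)) 0 q.1.1 q.1.2 (configShift x U)) / (siteBox 4 n).card) atTop
        (𝓝 (6 + (1 / 2 : ℝ) * deriv (freeEnergyDensity 4 (fundamentalRep (Fin 2))) b)) := by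
  classical
  have hb' : |b| ≤ 9 / 50 := abs_le.2 ⟨by linarith [hb.1], hb.2.le⟩
  obtain ⟨ν, hG, hinv⟩ := su2_wilson_oneState_translationInvariant hb'
  have hν : ν ∈ ymGibbsMeasures (d := 4) (fundamentalRep (Fin 2)) b := by rw [hG]; exact Set.mem_singleton ν
  have hνG : IsGibbsMeasure (ymSpecification (d := 4) (fundamentalRep (Fin 2)) b) ν := hν
  haveI := hνG.isProbabilityMeasure
  have hb2 : |b / 2| ≤ 9 / 100 := by rw [abs_div, abs_two]; linarith
  have hν2 : ν ∈ ymGibbsMeasures (d := 4) (fundamentalRep (Fin 2)) (2 * (b / 2)) := by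
    rw [show (2 : ℝ) * (b / 2) = b by ring]; exact hν
  obtain ⟨χ, hχ⟩ := PlaquetteSusceptibility.su2_summable_abs_cov_plaquette hb2 hν2
  have hsum : ∀ q : {q : Fin 4 × Fin 4 // q.1 < q.2}, Summable fun r : ZdPlaquette 4 =>
      |cov[zdPlaquetteObs (fundamentalRep (Fin 2)) 0 q.1.1 q.1.2,
        zdPlaquetteObs (fundamentalRep (Fin 2)) r.1 r.2.1.1 r.2.1.2; ν]| := fun q => (hχ (0, q)).1
  obtain ⟨hS, -⟩ := tsum_covariance_energy_shift_eq (d := 4) (N := 2) (ν := ν) hsum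
  set e : LGConfig 4 (Matrix.specialUnitaryGroup (Fin 2) ℂ) → ℝ :=
    fun U => ∑ q : {q : Fin 4 × Fin 4 // q.1 < q.2}, zdPlaquetteObs (fundamentalRep (Fin 2)) 0 q.1.1 q.1.2 U with he
  have hWm : ∀ q : {q : Fin 4 × Fin 4 // q.1 < q.2},
      Measurable (zdPlaquetteObs (d := 4) (fundamentalRep (Fin 2)) 0 q.1.1 q.1.2) := fun q =>
    (isLipschitzCylinder_zdPlaquetteObs (N := 2) 0 q.2).measurable
  have hem : Measurable e := Finset.measurable_sum _ fun q _ => hWm q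
  have heb : ∀ U, |e U| ≤ (Finset.univ : Finset {q : Fin 4 × Fin 4 // q.1 < q.2}).card := fun U => by
    refine (Finset.abs_sum_le_sum_abs _ _).trans ?_
    calc ∑ q : {q : Fin 4 × Fin 4 // q.1 < q.2}, |zdPlaquetteObs (fundamentalRep (Fin 2)) 0 q.1.1 q.1.2 U|
        ≤ ∑ _q : {q : Fin 4 × Fin 4 // q.1 < q.2}, (1 : ℝ) :=
          Finset.sum_le_sum fun q _ => abs_zdPlaquetteObs_le fundamentalRep_mem_unitaryGroup 0 q.1.1 q.1.2 U
      _ = (Finset.univ : Finset {q : Fin 4 × Fin 4 // q.1 < q.2}).card := by simp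
  have hlim := ErgodicAverages.ae_tendsto_boxAverage (d := 4) (by norm_num) hinv hem heb hS
  -- identify the mean with `6 + ½ f'(b)`
  have hderiv := (PressureRegularity.su2_hasDerivAt_freeEnergyDensity_of_mem hb hν).deriv
  have hcard : ((Finset.univ : Finset {q : Fin 4 × Fin 4 // q.1 < q.2}).card : ℝ) = 6 := by
    have h := numOrient_four
    unfold numOrient at h
    rw [Finset.card_univ]; exact_mod_cast h
  have hmean : ∫ U, e U ∂ν = 6 + (1 / 2 : ℝ) * deriv (freeEnergyDensity 4 (fundamentalRep (Fin 2))) b := by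
    have hint : ∫ U, e U ∂ν = ∑ q : {q : Fin 4 × Fin 4 // q.1 < q.2},
        ∫ U, zdPlaquetteObs (fundamentalRep (Fin 2)) 0 q.1.1 q.1.2 U ∂ν := by
      simp only [he]
      exact integral_finsetSum _ fun q _ => integrable_of_abs_le' (hWm q)
        (fun U => abs_zdPlaquetteObs_le fundamentalRep_mem_unitaryGroup 0 q.1.1 q.1.2 U)
    have hP : ∀ q : {q : Fin 4 × Fin 4 // q.1 < q.2}, ∫ U, plaquetteObs (fundamentalRep (Fin 2)) 0 q.1.1 q.1.2 U ∂ν =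
        2 * ∫ U, zdPlaquetteObs (fundamentalRep (Fin 2)) 0 q.1.1 q.1.2 U ∂ν := fun q => by
      rw [← integral_const_mul]
      refine integral_congr_ae (ae_of_all _ fun U => ?_)
      rw [CouplingResponse.plaquetteObs_fundamentalRep_eq_mul_zdPlaquetteObs]
      norm_num
    rw [hint, hderiv]
    simp only [hP]
    rw [Finset.sum_sub_distrib, Finset.sum_const, nsmul_eq_mul, hcard, ← Finset.mul_sum]
    ring
  refine ⟨ν, hG, ?_⟩
  rw [← hmean]
  exact hlim

end SpecificHeat

end Summit.Ventures.YMGap.RobustBall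

end
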